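import Literature.AlgebraicGeometry.Resolution.KollarSurfaceOrderReductionTameDimLeTwo
import Literature.AlgebraicGeometry.Resolution.BlowupSequencesOffCentres
import Literature.AlgebraicGeometry.Resolution.BlowupSequencesExtendOpen
import Literature.AlgebraicGeometry.Resolution.BlowupSequencesAppend
import HarnessLib

/-!
# Order reduction for marked ideals with finite cosupport on surfaces, tame regime: the GLOBAL blow-up sequence

Topic: `Literature/AlgebraicGeometry/Resolution`. J. Kollár, *Lectures on Resolution of
Singularities* (2007), Thm. 3.69 via 3.104 Step 2.2 / 3.111 Step 1 and the globalisation 3.105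
("There may not be a global smooth hypersurface of maximal contact … we can cover `X` with open
subsets … glue"); E. Bierstone, D. Grigoriev, P. Milman, J. Włodarczyk, arXiv:1206.3090, Def. 3.1.3,
Thm. 8.0.4. The local order reductions of `KollarSurfaceOrderReductionTame{,Local,DimLeTwo}.lean`
(at every closed point of dimension `≤ 2`, `max-ord 𝓘 ≤ b < p`) are assembled into ONE blow-up
sequence on `X` when the cosupport is FINITE: resolve near one point `x` inside the open missing
the other points and the boundary, extend the sequence to `X` by the same centres
(`BlowupSequencesExtendOpen.lean`), observe that nothing changed off `x`
(`BlowupSequencesOffCentres.lean`: the composite is an isomorphism there, the maximal order did not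
go up, the new boundary lies over `x` and the old boundary), and continue with the next point on
the new scheme (induction on the number of points; concatenation `BlowupSequencesAppend.lean`).

* `Kollar2007.exists_isResolutionOf_of_finite_support_boundary` — the induction statement: `X`
  smooth over a perfect field `k` of characteristic `p`, `(𝓘, E, b)` with `1 ≤ b`, `p = 0 ∨ b < p`,
  `max-ord 𝓘 ≤ b`, `E` snc with every member DISJOINT from the cosupport, the cosupport a finite
  set of closed points of dimension `≤ 2` ⟹ a resolution (`CentreSeq.IsResolutionOf`);
* **`Kollar2007.exists_isResolutionOf_of_finite_support`** — ORDER REDUCTION FOR `(X, 𝓘, ∅, b)`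
  ON `X` SMOOTH OVER A PERFECT FIELD OF CHARACTERISTIC `p` (`p = 0` ALLOWED) WITH `max-ord 𝓘 ≤ b`,
  `1 ≤ b < p`, AND FINITE COSUPPORT OF CLOSED POINTS OF DIMENSION `≤ 2`: a smooth blow-up sequence
  of order `b` on `X` with regular centres in the successive cosupports, simple normal crossings
  with the exceptional boundary, and EMPTY final cosupport;
* `Kollar2007.exists_isResolutionOf_of_finite_support_of_topologicalKrullDim_le_two` — in
  particular on every `X` of dimension `≤ 2` whose cosupport `cosupp(𝓘, b)` is a finite set of
  closed points.

What is NOT here: cosupports with one-dimensional components on a surface (Kollár 3.111 Step 1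
globally: blow up the regular curve `cosupp(𝓘, b)_{dim 1}` first — locally done in
`KollarSurfaceOrderReductionTameLocal.lean`), and `dim X ≥ 3`.

## Sources

* J. Kollár, *Lectures on Resolution of Singularities* (2007): Thm. 3.69, 3.70, 3.104 Step 2.2,
  3.105, 3.111 Step 1. [Kollar2007]
* E. Bierstone, D. Grigoriev, P. Milman, J. Włodarczyk, arXiv:1206.3090: Def. 3.1.3, Thm. 8.0.4.
  [BierstoneGrigorievMilmanWlodarczyk2011]
-/

noncomputable section

open CategoryTheory CategoryTheory.Limits AlgebraicGeometry TopologicalSpace IsLocalRing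
  Scheme.IdealSheafData

namespace Literature.AlgebraicGeometry.Resolution

universe u

namespace Kollar2007

variable (k : Type u) [Field k]

/-- Pulling back a boundary member disjoint from the image gives the unit ideal sheaf. [folklore] -/
private theorem comap_eq_top_of_disjoint_range {U X : Scheme.{u}} (j : U ⟶ X) (D : X.IdealSheafData)
    (h : Disjoint (Set.range j) (D.support : Set X)) : D.comap j = ⊤ := by
  rw [← support_eq_bot_iff]
  ext u
  simp only [support_comap, Closeds.coe_preimage, Set.mem_preimage, Closeds.coe_bot,
    Set.mem_empty_iff_false, iff_false]
  exact fun hu => Set.disjoint_left.mp h ⟨u, rfl⟩ hu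

/-- **The induction.** For `X` smooth over a perfect field `k` of characteristic `p`, a marked
ideal `(𝓘, E, b)` with `1 ≤ b`, `p = 0 ∨ b < p`, `max-ord 𝓘 ≤ b`, `E` a simple normal crossing
boundary each of whose members is disjoint from the cosupport, and finite cosupport consisting of
closed points of dimension `≤ 2`: there is a resolution. Induction on the number of points: local
resolution near one point inside the open missing the others and the boundary
(`exists_isResolutionOf_nhd_of_ringKrullDim_le_two`, boundary restored by
`IsResolutionOf.filter_ne_top`), extension to `X` (`CentreSeq.exists_extend_of_centresOver`),
bookkeeping off that point (`BlowupSequencesOffCentres.lean`), induction hypothesis on the top,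
concatenation. [cite: Kollar2007, Thm. 3.69, 3.105] [cite: BierstoneGrigorievMilmanWlodarczyk2011, Def. 3.1.3] -/
theorem exists_isResolutionOf_of_finite_support_boundary (p : ℕ) [CharP k p] [PerfectField k] :
    ∀ (N : ℕ) (X : Scheme.{u}) (f : X ⟶ Spec (.of k)) [Smooth f] (I : X.IdealSheafData)
      (E : List X.IdealSheafData) {b : ℕ}, 1 ≤ b → (p = 0 ∨ b < p) →
      (∀ x : X, idealOrder I x ≤ b) → HasSNC E →
      (⟨I, E, b⟩ : MarkedIdeal X).support.Finite →
      (∀ x ∈ (⟨I, E, b⟩ : MarkedIdeal X).support, IsClosed ({x} : Set X)) →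
      (∀ x ∈ (⟨I, E, b⟩ : MarkedIdeal X).support, ringKrullDim (X.presheaf.stalk x) ≤ 2) →
      (∀ D ∈ E, Disjoint (D.support : Set X) (⟨I, E, b⟩ : MarkedIdeal X).support) →
      (⟨I, E, b⟩ : MarkedIdeal X).support.ncard ≤ N →
      ∃ s : CentreSeq X, s.IsResolutionOf ⟨I, E, b⟩ := by
  classical
  intro N
  induction N with
  | zero =>
    intro X f _ I E b hb hbp hmax hE hfin hcl hdim hdisj hN
    have hS : (⟨I, E, b⟩ : MarkedIdeal X).support = ∅ :=
      (Set.ncard_eq_zero hfin).mp (Nat.le_zero.mp hN)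
    exact ⟨CentreSeq.nil X, (CentreSeq.isResolutionOf_nil_iff _).mpr hS⟩
  | succ N ih =>
    intro X f _ I E b hb hbp hmax hE hfin hcl hdim hdisj hN
    letI : X.Over (Spec (.of k)) := ⟨f⟩
    haveI : Smooth (X ↘ Spec (.of k)) := inferInstanceAs (Smooth f)
    haveI : IsLocallyNoetherian X := isLocallyNoetherian_of_locallyOfFiniteType_over k X
    have hXreg : Scheme.IsRegular X := Scheme.isRegular_of_smooth_over_field k X
    set M : MarkedIdeal X := ⟨I, E, b⟩ with hM
    by_cases hS : M.support = ∅
    · exact ⟨CentreSeq.nil X, (CentreSeq.isResolutionOf_nil_iff _).mpr hS⟩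
    obtain ⟨x, hxS⟩ := Set.nonempty_iff_ne_empty.mpr hS
    have hxcl : IsClosed ({x} : Set X) := hcl x hxS
    -- the open `V` missing the other points of the cosupport and the boundary
    set F : Set X := (M.support \ {x}) ∪ ⋃ D ∈ E, (D.support : Set X) with hFdef
    have hF : IsClosed F := by
      refine IsClosed.union ?_ ((List.finite_toSet E).isClosed_biUnion fun D _ => D.support.isClosed)
      rw [← Set.biUnion_of_singleton (M.support \ {x})]
      exact hfin.sdiff.isClosed_biUnion fun y hy => hcl y hy.1
    have hxF : x ∉ F := by
      rintro (⟨-, hx⟩ | hx)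
      · exact hx rfl
      · obtain ⟨D, hD, hxD⟩ := Set.mem_iUnion₂.mp hx
        exact Set.disjoint_left.mp (hdisj D hD) hxD hxS
    let V : X.Opens := ⟨Fᶜ, hF.isOpen_compl⟩
    have hxV : x ∈ V := hxF
    -- local resolution near `x` inside `V`
    haveI : Smooth ((V : Scheme.{u}) ↘ Spec (.of k)) :=
      inferInstanceAs (Smooth (V.ι ≫ X ↘ Spec (.of k)))
    have hinjV : Function.Injective (V : X.Opens).ι := V.ι.isOpenEmbedding.injective
    let xV : (V : Scheme.{u}) := ⟨x, hxV⟩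
    have hxVx : V.ι xV = x := rfl
    have hxVcl : IsClosed ({xV} : Set (V : Scheme.{u})) := by
      have : ({xV} : Set (V : Scheme.{u})) = V.ι ⁻¹' {x} := by
        ext y
        simp only [Set.mem_singleton_iff, Set.mem_preimage]
        exact ⟨fun h => by rw [h, hxVx], fun h => hinjV (by rw [h, hxVx])⟩
      rw [this]
      exact hxcl.preimage V.ι.continuous
    have hdimV : ringKrullDim ((V : Scheme.{u}).presheaf.stalk xV) ≤ 2 := by
      rw [ringKrullDim_stalk_opens, hxVx]; exact hdim x hxS
    have hmaxV : ∀ y : (V : Scheme.{u}), idealOrder (I.comap V.ι) y ≤ b := fun y => by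
      rw [idealOrder_comap_of_isOpenImmersion]; exact hmax _
    obtain ⟨U, hxU, s₀, hs₀⟩ := exists_isResolutionOf_nhd_of_ringKrullDim_le_two k (V : Scheme.{u}) p
      (I.comap V.ι) hb hbp hmaxV xV hxVcl hdimV
    -- the open immersion `j : U → X`
    let j : (U : Scheme.{u}) ⟶ X := U.ι ≫ V.ι
    haveI : IsOpenImmersion j := inferInstance
    haveI : IsLocallyNoetherian (U : Scheme.{u}) := LocallyOfFiniteType.isLocallyNoetherian j
    have hjV : ∀ u : (U : Scheme.{u}), j u ∈ (V : Set X) := fun u => (U.ι u).2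
    have hx_range : ({x} : Set X) ⊆ Set.range j := by
      rintro _ rfl; exact ⟨⟨xV, hxU⟩, rfl⟩
    -- `s₀` resolves `j^* M`
    have hEtop : ∀ D ∈ E, D.comap j = ⊤ := fun D hD =>
      comap_eq_top_of_disjoint_range j D (Set.disjoint_left.mpr (by
        rintro _ ⟨u, rfl⟩ hu
        exact hjV u (Or.inr (Set.mem_iUnion₂.mpr ⟨D, hD, hu⟩))))
    have hfilter : (E.map (·.comap j)).filter (fun D => D ≠ ⊤) = [] :=
      List.filter_eq_nil_iff.mpr (by
        intro D' hD'
        obtain ⟨D, hD, rfl⟩ := List.mem_map.mp hD'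
        simp [hEtop D hD])
    have hsncj : HasSNC (E.map (·.comap j)) := by
      have := hE.comap_of_isOpenImmersion j
      rwa [Scheme.IdealSheafData.comap_top] at this
    have hs₀M : s₀.IsResolutionOf (M.comap j) := by
      change s₀.IsResolutionOf ⟨I.comap j, E.map (·.comap j), b⟩
      rw [CentreSeq.IsResolutionOf.filter_ne_top s₀ hsncj, hfilter,
        show I.comap j = (I.comap V.ι).comap U.ι from Scheme.IdealSheafData.comap_comp I U.ι V.ι]
      exact hs₀
    -- extension to `X`
    have hsuppj : (M.comap j).support ⊆ j ⁻¹' {x} := by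
      rw [MarkedIdeal.support_comap_of_isOpenImmersion]
      intro u hu
      by_contra hne
      exact hjV u (Or.inl ⟨hu, hne⟩)
    have hover₀ : s₀.CentresOver (j ⁻¹' {x}) :=
      CentreSeq.CentresOver.mono s₀ hsuppj (CentreSeq.IsAdmissibleFor.centresOver_support s₀ _ hs₀M.1)
    obtain ⟨t, htadm, htover, htpb⟩ :=
      CentreSeq.exists_extend_of_centresOver s₀ j M {x} hxcl hx_range hE hs₀M.1 hover₀
    -- the top `X₁` of the extended sequence is smooth over `k`
    haveI : IsProper t.comp := t.isProper_comp
    have hX₁reg : Scheme.IsRegular t.top :=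
      (CentreSeq.IsAdmissibleFor.isMultipleBlowup t M htadm).isRegular hXreg
    haveI : Smooth (t.comp ≫ f) := smooth_of_isRegular_of_perfectField _ hX₁reg
    -- the transformed marked ideal
    set M₁ : MarkedIdeal t.top := t.transformMarked M with hM₁
    have hM₁eq : (⟨M₁.ideal, M₁.boundary, b⟩ : MarkedIdeal t.top) = M₁ := by
      rw [show b = M₁.mult from (CentreSeq.transformMarked_mult t M).symm]
    have hmax₁ : ∀ y : t.top, idealOrder M₁.ideal y ≤ b :=
      CentreSeq.IsAdmissibleFor.forall_idealOrder_transformMarked_le t M hXreg htadm hmax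
    have hE₁ : HasSNC M₁.boundary := CentreSeq.IsAdmissibleFor.hasSNC_transformMarked_boundary t M htadm hE
    have hsub₁ : M₁.support ⊆ t.comp ⁻¹' (M.support \ {x}) := by
      intro y hy
      refine ⟨CentreSeq.IsAdmissibleFor.support_transformMarked_subset_preimage t M htadm hy,
        fun hyx => ?_⟩
      exact CentreSeq.support_transformMarked_subset_compl_preimage_range t j M htpb hs₀M hy
        (hx_range hyx)
    have hinj : Set.InjOn t.comp M₁.support := fun y hy y' _ heq => by
      obtain ⟨z, -, hz⟩ := htover.exists_unique_comp_eq_of_not_mem hxcl (hsub₁ hy).2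
      exact (hz y rfl).trans (hz y' heq.symm).symm
    have hfin₁ : M₁.support.Finite :=
      Set.Finite.of_finite_image (hfin.sdiff.subset (Set.image_subset_iff.mpr hsub₁)) hinj
    have hcl₁ : ∀ y ∈ M₁.support, IsClosed ({y} : Set t.top) := fun y hy =>
      htover.isClosed_singleton_of_comp_eq hxcl (hsub₁ hy).2 (hcl _ (hsub₁ hy).1) rfl
    have hdim₁ : ∀ y ∈ M₁.support, ringKrullDim (t.top.presheaf.stalk y) ≤ 2 := fun y hy => by
      haveI := htover.isIso_stalkMap_comp_of_not_mem hxcl (hsub₁ hy).2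
      rw [← ringKrullDim_eq_of_ringEquiv (asIso (t.comp.stalkMap y)).commRingCatIsoToRingEquiv]
      exact hdim _ (hsub₁ hy).1
    have hdisj₁ : ∀ D' ∈ M₁.boundary, Disjoint (D'.support : Set t.top) M₁.support := fun D' hD' => by
      refine Set.disjoint_left.mpr fun y hyD hyS => ?_
      have h1 := htover.support_boundary_transformMarked_subset t M {x} D' hD' hyD
      obtain ⟨hyS', hyx⟩ := hsub₁ hyS
      rcases h1 with h | h
      · exact hyx h
      · obtain ⟨D, hD, hD'⟩ := Set.mem_iUnion₂.mp h
        exact Set.disjoint_left.mp (hdisj D hD) hD' hyS'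
    have hN₁ : M₁.support.ncard ≤ N := by
      have h1 : M₁.support.ncard ≤ (M.support \ {x}).ncard :=
        Set.ncard_le_ncard_of_injOn t.comp (fun y hy => hsub₁ hy) hinj hfin.sdiff
      have h2 := Set.ncard_sdiff_singleton_add_one hxS hfin
      omega
    -- the induction hypothesis on `X₁`, and concatenation
    rw [← hM₁eq] at hfin₁ hcl₁ hdim₁ hdisj₁ hN₁
    obtain ⟨s₁, hs₁⟩ := ih t.top (t.comp ≫ f) M₁.ideal M₁.boundary hb hbp hmax₁ hE₁ hfin₁ hcl₁ hdim₁
      hdisj₁ hN₁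
    rw [hM₁eq] at hs₁
    exact ⟨t.append s₁, htadm.append hs₁⟩

/-- **Order reduction for marked ideals with finite cosupport on a surface, tame regime — the
global blow-up sequence.** Let `X` be smooth over a perfect field `k` of characteristic `p`
(`p = 0` allowed), `𝓘` an ideal sheaf with `max-ord 𝓘 ≤ b`, `1 ≤ b`, `p = 0 ∨ b < p`, whose
cosupport `cosupp(𝓘, b)` is a FINITE set of closed points of dimension `≤ 2`. Then there is a
smooth blow-up sequence on `X` RESOLVING `(X, 𝓘, ∅, b)` in the sense of BGMW Def. 3.1.3
(`CentreSeq.IsResolutionOf`: regular centres inside the successive cosupports, simple normal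
crossings with the exceptional boundary, final cosupport empty).
[cite: Kollar2007, Thm. 3.69, 3.105] [cite: BierstoneGrigorievMilmanWlodarczyk2011, Def. 3.1.3, Thm. 8.0.4] -/
theorem exists_isResolutionOf_of_finite_support (X : Scheme.{u}) [X.Over (Spec (.of k))] (p : ℕ)
    [CharP k p] [PerfectField k] [Smooth (X ↘ Spec (.of k))] (I : X.IdealSheafData) {b : ℕ}
    (hb : 1 ≤ b) (hbp : p = 0 ∨ b < p) (hmax : ∀ x : X, idealOrder I x ≤ b)
    (hfin : (⟨I, [], b⟩ : MarkedIdeal X).support.Finite)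
    (hcl : ∀ x ∈ (⟨I, [], b⟩ : MarkedIdeal X).support, IsClosed ({x} : Set X))
    (hdim : ∀ x ∈ (⟨I, [], b⟩ : MarkedIdeal X).support, ringKrullDim (X.presheaf.stalk x) ≤ 2) :
    ∃ s : CentreSeq X, s.IsResolutionOf ⟨I, [], b⟩ := by
  haveI : IsLocallyNoetherian X := isLocallyNoetherian_of_locallyOfFiniteType_over k X
  exact exists_isResolutionOf_of_finite_support_boundary k p _ X (X ↘ Spec (.of k)) I [] hb hbp hmax
    (hasSNC_nil_of_isRegular (Scheme.isRegular_of_smooth_over_field k X)) hfin hcl hdim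
    (fun D hD => by simp at hD) le_rfl

/-- **On a scheme of dimension `≤ 2`**: order reduction for `(X, 𝓘, ∅, b)` in the tame regime
whenever the cosupport is a finite set of closed points. [cite: Kollar2007, Thm. 3.69, 3.105]
[cite: BierstoneGrigorievMilmanWlodarczyk2011, Thm. 8.0.4] -/
theorem exists_isResolutionOf_of_finite_support_of_topologicalKrullDim_le_two (X : Scheme.{u})
    [X.Over (Spec (.of k))] (p : ℕ) [CharP k p] [PerfectField k] [Smooth (X ↘ Spec (.of k))]
    (hX : topologicalKrullDim X ≤ 2) (I : X.IdealSheafData) {b : ℕ} (hb : 1 ≤ b)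
    (hbp : p = 0 ∨ b < p) (hmax : ∀ x : X, idealOrder I x ≤ b)
    (hfin : (⟨I, [], b⟩ : MarkedIdeal X).support.Finite)
    (hcl : ∀ x ∈ (⟨I, [], b⟩ : MarkedIdeal X).support, IsClosed ({x} : Set X)) :
    ∃ s : CentreSeq X, s.IsResolutionOf ⟨I, [], b⟩ :=
  exists_isResolutionOf_of_finite_support k X p I hb hbp hmax hfin hcl
    fun x _ => (ringKrullDim_stalk_le_topologicalKrullDim X x).trans hX

end Kollar2007

end Literature.AlgebraicGeometry.Resolution

end
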